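import Summits.Ventures.Crystal3D.Theorems.StickyWulffConstantNoReconstructionGainExactLevelSample
import Summits.Ventures.Crystal3D.Theorems.StickyWulffConstantNoReconstructionGainLowCoordAdhesion
import HarnessLib

/-!
# EXACT₀ ⟹ the crux's inequality for every packing with an off-lattice-free interior level, and for
# every packing with few off-lattice wrapped balls (line `replication-exactness`, toward UNWRAP)

HONEST FRAMING. Part of the venture `Summits/Ventures/Crystal3D` (cell `crystal3d-full`), supports the
crux `NoReconstructionGain` (stmt-Ventures-19144, route `route-Ventures-StickyWulffConstant`), line
`replication-exactness` (lead wulff-p1 g17).  Assembles `…ExactLevel` (LEVEL SANDWICH) and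
`…ExactLevelSample` (lattice bonds of the sample across an interior level):

* `deficit_ge_of_exactZeroGain_of_level` — **EXACT₀ ⟹ `D(X) ≥ 2φ(ν)πρ² − Cρ` for every unit packing
  `X ⊇ P_ρ(ν,R)` (`R ≥ 3`, `ρ ≥ R`) and every interior level `t₀ ∈ [−2R+1, −R−2]` from which every
  off-lattice ball of `X` keeps height-distance `≥ 1`.**  No core reduction, no compatible/wrapped split.
* `deficit_ge_of_exactZeroGain_of_few_offLattice` — **EXACT₀ ⟹ the same for every unit packing
  `X ⊇ P_ρ(ν,R)` (`R ≥ 5`) with fewer than `⌊(R−3)/2⌋` off-lattice balls of height in `(−2R, −R−1)`**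
  (pigeonhole over the disjoint levels `−2R+1+2k`).  Off-lattice balls of such height lie outside the disc
  (inside, the slab sample leaves no room), so these are the WRAPPED off-lattice balls: the theorem covers
  the compatible sector (`stub_compatibleAdhesion_of_exactZeroGain`) and every packing whose wrapped part is
  on-lattice (arbitrary lateral lattice continuations of the slab, with arbitrary films elsewhere).

* `deficit_ge_of_exactZeroGain_sub_offLattice` — the quantitative form: for EVERY packing,
  `D(X) ≥ 2φ(ν)πρ² − Cρ − 12(⌊#S/K⌋ + 1)` with `S` the wrapped off-lattice balls and `K = ⌊(R−3)/2⌋`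
  (delete the balls near the least-loaded level; `card_cross_le_twelve_mul`,
  `contactDeficiency_nonneg_of_packing`).  So `#S ≤ L·K·ρ` gives the crux's inequality with constant
  `C + 12L + 12`.

So, given EXACT₀, the residual UNWRAP of the line is reduced to packings (cores) with more than `L·K·ρ`
(`K ≈ R/2`) off-lattice wrapped balls — a CONFINEMENT question for cores.

WHAT THIS IS NOT: that confinement, and EXACT₀ itself (`stub_noCriminal`), are open; rung F-C1 not moved.
-/

noncomputable section

namespace Summit.Ventures.Crystal3D.Theorems

open Summit.Ventures.Crystal3D
open Literature.MathematicalPhysics.StatisticalMechanics (fccStacking contactDeficiency orderedContacts)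
open scoped InnerProductSpace
open Finset

/-- **EXACT₀ ⟹ the crux's inequality off an off-lattice-free interior level.** -/
theorem deficit_ge_of_exactZeroGain_of_level (hE : ExactZeroGain) (R : ℝ) (hR : 3 ≤ R) :
    ∃ C : ℝ, ∀ ν : EuclideanSpace ℝ (Fin 3), ‖ν‖ = 1 → ∀ ρ : ℝ, R ≤ ρ →
      ∀ X P : Finset (EuclideanSpace ℝ (Fin 3)),
      (∀ p ∈ X, ∀ q ∈ X, p ≠ q → 1 ≤ dist p q) → P ⊆ X →
      (∀ p, p ∈ P ↔ (p ∈ fccStacking 1 (Real.sqrt (2 / 3)) ∧ -(2 * R) ≤ ⟪p, ν⟫_ℝ ∧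
        ⟪p, ν⟫_ℝ ≤ -R ∧ ‖p‖ ^ 2 - ⟪p, ν⟫_ℝ ^ 2 ≤ ρ ^ 2)) →
      ∀ t₀ : ℝ, -(2 * R) + 1 ≤ t₀ → t₀ ≤ -R - 2 →
      (∀ x ∈ X, x ∉ fccStacking 1 (Real.sqrt (2 / 3)) → 1 ≤ |⟪x, ν⟫_ℝ - t₀|) →
      2 * (Real.sqrt 2 / 4 * ∑ᶠ w ∈ {w ∈ fccStacking 1 (Real.sqrt (2 / 3)) | ‖w‖ = 1},
          |⟪w, ν⟫_ℝ|) * Real.pi * ρ ^ 2 - C * ρ ≤ contactDeficiency X := by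
  classical
  obtain ⟨C, hC⟩ := sample_latticeCross_ge R hR
  refine ⟨C, ?_⟩
  intro ν hν ρ hρ X P hX hPX hP t₀ ht₀lo ht₀hi hoff
  have h1 := hC ν hν ρ hρ t₀ ht₀lo ht₀hi P hP
  have h2 := contactDeficiency_ge_latticeCross_of_exactZeroGain hE hν X hX t₀ hoff
  -- the sample's crossing bonds are lattice bonds of `X` crossing the level
  have hsub : (((P.filter fun x => ⟪x, ν⟫_ℝ ≤ t₀) ×ˢ (P.filter fun y => ¬ ⟪y, ν⟫_ℝ ≤ t₀)).filter
      fun pq => dist pq.1 pq.2 = 1) ⊆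
      ((X ×ˢ X).filter fun pq : EuclideanSpace ℝ (Fin 3) × EuclideanSpace ℝ (Fin 3) =>
        pq.1 ∈ fccStacking 1 (Real.sqrt (2 / 3)) ∧ pq.2 ∈ fccStacking 1 (Real.sqrt (2 / 3)) ∧
          dist pq.1 pq.2 = 1 ∧ ⟪pq.1, ν⟫_ℝ ≤ t₀ ∧ t₀ < ⟪pq.2, ν⟫_ℝ) := by
    intro pq hpq
    simp only [Finset.mem_filter, Finset.mem_product] at hpq ⊢
    obtain ⟨⟨⟨hx, hxt⟩, ⟨hy, hyt⟩⟩, hd⟩ := hpq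
    exact ⟨⟨hPX hx, hPX hy⟩, ((hP _).1 hx).1, ((hP _).1 hy).1, hd, hxt, not_le.1 hyt⟩
  have h3 := Finset.card_le_card hsub
  have h3' : ((((P.filter fun x => ⟪x, ν⟫_ℝ ≤ t₀) ×ˢ (P.filter fun y => ¬ ⟪y, ν⟫_ℝ ≤ t₀)).filter
      fun pq => dist pq.1 pq.2 = 1).card : ℝ) ≤
      (((X ×ˢ X).filter fun pq : EuclideanSpace ℝ (Fin 3) × EuclideanSpace ℝ (Fin 3) =>
        pq.1 ∈ fccStacking 1 (Real.sqrt (2 / 3)) ∧ pq.2 ∈ fccStacking 1 (Real.sqrt (2 / 3)) ∧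
          dist pq.1 pq.2 = 1 ∧ ⟪pq.1, ν⟫_ℝ ≤ t₀ ∧ t₀ < ⟪pq.2, ν⟫_ℝ).card : ℝ) := by
    exact_mod_cast h3
  linarith

open scoped Classical in
/-- **EXACT₀ ⟹ the crux's inequality for every packing with few off-lattice wrapped balls.**  For
`R ≥ 5` there is `C` such that every unit packing `X ⊇ P_ρ(ν,R)` (`ρ ≥ R`) with fewer than `⌊(R−3)/2⌋`
off-lattice balls of `ν`-height in `(−2R, −R−1)` has `D(X) ≥ 2φ(ν)πρ² − Cρ`. -/
theorem deficit_ge_of_exactZeroGain_of_few_offLattice (hE : ExactZeroGain) (R : ℝ) (hR : 5 ≤ R) :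
    ∃ C : ℝ, ∀ ν : EuclideanSpace ℝ (Fin 3), ‖ν‖ = 1 → ∀ ρ : ℝ, R ≤ ρ →
      ∀ X P : Finset (EuclideanSpace ℝ (Fin 3)),
      (∀ p ∈ X, ∀ q ∈ X, p ≠ q → 1 ≤ dist p q) → P ⊆ X →
      (∀ p, p ∈ P ↔ (p ∈ fccStacking 1 (Real.sqrt (2 / 3)) ∧ -(2 * R) ≤ ⟪p, ν⟫_ℝ ∧
        ⟪p, ν⟫_ℝ ≤ -R ∧ ‖p‖ ^ 2 - ⟪p, ν⟫_ℝ ^ 2 ≤ ρ ^ 2)) →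
      (X.filter fun x => x ∉ fccStacking 1 (Real.sqrt (2 / 3)) ∧ -(2 * R) < ⟪x, ν⟫_ℝ ∧
        ⟪x, ν⟫_ℝ < -R - 1).card < ⌊(R - 3) / 2⌋₊ →
      2 * (Real.sqrt 2 / 4 * ∑ᶠ w ∈ {w ∈ fccStacking 1 (Real.sqrt (2 / 3)) | ‖w‖ = 1},
          |⟪w, ν⟫_ℝ|) * Real.pi * ρ ^ 2 - C * ρ ≤ contactDeficiency X := by
  classical
  obtain ⟨C, hC⟩ := deficit_ge_of_exactZeroGain_of_level hE R (by linarith)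
  refine ⟨C, ?_⟩
  intro ν hν ρ hρ X P hX hPX hP hfew
  set K : ℕ := ⌊(R - 3) / 2⌋₊ with hK
  set S := X.filter fun x => x ∉ fccStacking 1 (Real.sqrt (2 / 3)) ∧ -(2 * R) < ⟪x, ν⟫_ℝ ∧
    ⟪x, ν⟫_ℝ < -R - 1 with hS
  -- band index of a wrapped off-lattice ball
  set f : EuclideanSpace ℝ (Fin 3) → ℕ := fun x => ⌊(⟪x, ν⟫_ℝ + 2 * R) / 2⌋₊ with hf
  -- some band index below `K` is missed
  have hmiss : ∃ k, k < K ∧ ∀ x ∈ S, f x ≠ k := by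
    by_contra h
    push Not at h
    have hsurj : Finset.range K ⊆ S.image f := by
      intro k hk
      obtain ⟨x, hx, hfx⟩ := h k (Finset.mem_range.1 hk)
      exact Finset.mem_image.2 ⟨x, hx, hfx⟩
    have := (Finset.card_le_card hsurj).trans Finset.card_image_le
    rw [Finset.card_range] at this
    exact absurd hfew (not_lt.2 this)
  obtain ⟨k, hkK, hk⟩ := hmiss
  have hKR : (K : ℝ) ≤ (R - 3) / 2 := Nat.floor_le (by linarith)
  have hkR : (k : ℝ) ≤ (R - 3) / 2 - 1 := by
    have : (k : ℝ) + 1 ≤ K := by exact_mod_cast hkK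
    linarith
  have hk0 : (0 : ℝ) ≤ k := Nat.cast_nonneg k
  -- the level `t₀ = −2R + 1 + 2k`
  refine hC ν hν ρ hρ X P hX hPX hP (-(2 * R) + 1 + 2 * k) (by linarith) (by linarith) ?_
  intro x hx hxΛ
  by_contra hlt
  push Not at hlt
  rw [abs_lt] at hlt
  obtain ⟨h1, h2⟩ := hlt
  have hxS : x ∈ S := by
    rw [hS, Finset.mem_filter]
    exact ⟨hx, hxΛ, by linarith, by linarith⟩
  have hfx : f x = k := by
    rw [hf]
    refine (Nat.floor_eq_iff (by linarith)).2 ⟨?_, ?_⟩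
    · have : (k : ℝ) * 2 ≤ ⟪x, ν⟫_ℝ + 2 * R := by linarith
      linarith
    · have : ⟪x, ν⟫_ℝ + 2 * R < ((k : ℝ) + 1) * 2 := by linarith
      linarith
  exact hk x hxS hfx

/-- A set of film balls receives at most `12` bonds per ball from the rest of a packing. -/
theorem card_cross_le_twelve_mul (X B : Finset (EuclideanSpace ℝ (Fin 3)))
    (hX : ∀ p ∈ X, ∀ q ∈ X, p ≠ q → 1 ≤ dist p q) :
    (((X \ B) ×ˢ B).filter fun pq => dist pq.1 pq.2 = 1).card ≤ 12 * B.card := by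
  classical
  rw [card_cross_eq_sum]
  calc ∑ q ∈ B, ((X \ B).filter fun p => dist p q = 1).card ≤ ∑ q ∈ B, 12 := by
        refine Finset.sum_le_sum fun q _ => ?_
        calc ((X \ B).filter fun p => dist p q = 1).card ≤ (X.filter fun p => dist q p = 1).card := by
              refine Finset.card_le_card fun p hp => ?_
              rw [Finset.mem_filter] at hp ⊢
              exact ⟨(Finset.mem_sdiff.1 hp.1).1, by rw [dist_comm]; exact hp.2⟩
          _ ≤ 12 := card_partners_le_twelve X hX q
    _ = 12 * B.card := by rw [Finset.sum_const, smul_eq_mul, mul_comm]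

/-- The deficiency of a unit packing is nonnegative (kissing number). -/
theorem contactDeficiency_nonneg_of_packing (B : Finset (EuclideanSpace ℝ (Fin 3)))
    (hB : ∀ p ∈ B, ∀ q ∈ B, p ≠ q → 1 ≤ dist p q) : 0 ≤ contactDeficiency B := by
  classical
  unfold contactDeficiency Literature.MathematicalPhysics.StatisticalMechanics.orderedContacts
  rw [card_cross_eq_sum]
  have h : ∑ q ∈ B, (B.filter fun p => dist p q = 1).card ≤ 12 * B.card := by
    calc ∑ q ∈ B, (B.filter fun p => dist p q = 1).card ≤ ∑ q ∈ B, 12 := by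
          refine Finset.sum_le_sum fun q _ => ?_
          calc (B.filter fun p => dist p q = 1).card = (B.filter fun p => dist q p = 1).card := by
                congr 1; ext p; simp only [Finset.mem_filter, dist_comm]
            _ ≤ 12 := card_partners_le_twelve B hB q
      _ = 12 * B.card := by rw [Finset.sum_const, smul_eq_mul, mul_comm]
  have h' : ((∑ q ∈ B, (B.filter fun p => dist p q = 1).card : ℕ) : ℝ) ≤ 12 * (B.card : ℝ) := by
    exact_mod_cast h
  push_cast at h' ⊢
  linarith

open scoped Classical in
/-- **EXACT₀ ⟹ the crux's inequality up to `12` per off-lattice wrapped ball near the best level.**  For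
`R ≥ 5` there is `C` such that every unit packing `X ⊇ P_ρ(ν,R)` (`ρ ≥ R`) satisfies
`D(X) ≥ 2φ(ν)πρ² − Cρ − 12·(⌊#S / K⌋ + 1)`, where `S` is the set of its off-lattice balls of height in
`(−2R, −R−1)` (the wrapped off-lattice balls) and `K = ⌊(R−3)/2⌋`: delete the off-lattice balls near the
least-loaded of the `K` disjoint interior levels (each costs `≤ 12` bonds) and apply
`deficit_ge_of_exactZeroGain_of_level`.  In particular `#S ≤ L·K·ρ` gives the crux's inequality with
constant `C + 12L + 12`. -/
theorem deficit_ge_of_exactZeroGain_sub_offLattice (hE : ExactZeroGain) (R : ℝ) (hR : 5 ≤ R) :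
    ∃ C : ℝ, ∀ ν : EuclideanSpace ℝ (Fin 3), ‖ν‖ = 1 → ∀ ρ : ℝ, R ≤ ρ →
      ∀ X P : Finset (EuclideanSpace ℝ (Fin 3)),
      (∀ p ∈ X, ∀ q ∈ X, p ≠ q → 1 ≤ dist p q) → P ⊆ X →
      (∀ p, p ∈ P ↔ (p ∈ fccStacking 1 (Real.sqrt (2 / 3)) ∧ -(2 * R) ≤ ⟪p, ν⟫_ℝ ∧
        ⟪p, ν⟫_ℝ ≤ -R ∧ ‖p‖ ^ 2 - ⟪p, ν⟫_ℝ ^ 2 ≤ ρ ^ 2)) →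
      2 * (Real.sqrt 2 / 4 * ∑ᶠ w ∈ {w ∈ fccStacking 1 (Real.sqrt (2 / 3)) | ‖w‖ = 1},
          |⟪w, ν⟫_ℝ|) * Real.pi * ρ ^ 2 - C * ρ -
          12 * ((((X.filter fun x => x ∉ fccStacking 1 (Real.sqrt (2 / 3)) ∧ -(2 * R) < ⟪x, ν⟫_ℝ ∧
            ⟪x, ν⟫_ℝ < -R - 1).card / ⌊(R - 3) / 2⌋₊ : ℕ) : ℝ) + 1) ≤ contactDeficiency X := by
  classical
  obtain ⟨C, hC⟩ := deficit_ge_of_exactZeroGain_of_level hE R (by linarith)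
  refine ⟨C, ?_⟩
  intro ν hν ρ hρ X P hX hPX hP
  set K : ℕ := ⌊(R - 3) / 2⌋₊ with hK
  set S := X.filter fun x => x ∉ fccStacking 1 (Real.sqrt (2 / 3)) ∧ -(2 * R) < ⟪x, ν⟫_ℝ ∧
    ⟪x, ν⟫_ℝ < -R - 1 with hS
  set f : EuclideanSpace ℝ (Fin 3) → ℕ := fun x => ⌊(⟪x, ν⟫_ℝ + 2 * R) / 2⌋₊ with hf
  have hK1 : 1 ≤ K := by
    rw [hK]; exact Nat.one_le_floor_iff _ |>.2 (by linarith)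
  have hKpos : 0 < K := hK1
  -- a least-loaded level
  obtain ⟨k, hkK, hk⟩ := Finset.exists_card_fiber_le_of_card_le_mul (f := f) (s := S)
    (t := Finset.range K) ⟨0, Finset.mem_range.2 hKpos⟩ (n := S.card / K + 1)
    (by rw [Finset.card_range]; have := Nat.lt_div_mul_add (a := S.card) hKpos; nlinarith [this])
  rw [Finset.mem_range] at hkK
  set B := S.filter fun x => f x = k with hB
  have hBS : B ⊆ S := Finset.filter_subset _ _
  have hSX : S ⊆ X := Finset.filter_subset _ _
  have hBX : B ⊆ X := hBS.trans hSX
  -- delete `B`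
  set X' := X \ B with hX'
  have hX'X : X' ⊆ X := Finset.sdiff_subset
  have hX'pack : ∀ p ∈ X', ∀ q ∈ X', p ≠ q → 1 ≤ dist p q :=
    fun p hp q hq hne => hX p (hX'X hp) q (hX'X hq) hne
  have hPX' : P ⊆ X' := by
    intro p hp
    rw [hX', Finset.mem_sdiff]
    refine ⟨hPX hp, fun hpB => ?_⟩
    have := (Finset.mem_filter.1 (hBS hpB)).2.1
    exact this ((hP p).1 hp).1
  have hKR : (K : ℝ) ≤ (R - 3) / 2 := Nat.floor_le (by linarith)
  have hkR : (k : ℝ) ≤ (R - 3) / 2 - 1 := by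
    have : (k : ℝ) + 1 ≤ K := by exact_mod_cast hkK
    linarith
  have hk0 : (0 : ℝ) ≤ k := Nat.cast_nonneg k
  -- the level `−2R + 1 + 2k` is off-lattice-free for `X'`
  have hlevel : ∀ x ∈ X', x ∉ fccStacking 1 (Real.sqrt (2 / 3)) →
      1 ≤ |⟪x, ν⟫_ℝ - (-(2 * R) + 1 + 2 * k)| := by
    intro x hx hxΛ
    by_contra hlt
    push Not at hlt
    rw [abs_lt] at hlt
    obtain ⟨h1, h2⟩ := hlt
    have hxS : x ∈ S := by
      rw [hS, Finset.mem_filter]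
      exact ⟨hX'X hx, hxΛ, by linarith, by linarith⟩
    have hfx : f x = k := by
      rw [hf]
      refine (Nat.floor_eq_iff (by linarith)).2 ⟨?_, ?_⟩
      · have : (k : ℝ) * 2 ≤ ⟪x, ν⟫_ℝ + 2 * R := by linarith
        linarith
      · have : ⟪x, ν⟫_ℝ + 2 * R < ((k : ℝ) + 1) * 2 := by linarith
        linarith
    have hxB : x ∈ B := by rw [hB, Finset.mem_filter]; exact ⟨hxS, hfx⟩
    exact (Finset.mem_sdiff.1 hx).2 hxB
  have hDX' := hC ν hν ρ hρ X' P hX'pack hPX' hP (-(2 * R) + 1 + 2 * k) (by linarith) (by linarith) hlevel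
  -- put `B` back
  have hsplit := contactDeficiency_sdiff_split (X := X) (P := X') hX'X
  have hXB : X \ X' = B := by
    rw [hX', Finset.sdiff_sdiff_eq_self hBX]
  rw [hXB] at hsplit
  have hcross := card_cross_le_twelve_mul X B hX
  have hDB := contactDeficiency_nonneg_of_packing B fun p hp q hq hne => hX p (hBX hp) q (hBX hq) hne
  have hcross' : ((((X \ B) ×ˢ B).filter fun pq => dist pq.1 pq.2 = 1).card : ℝ) ≤ 12 * (B.card : ℝ) := by
    exact_mod_cast hcross
  have hBcard : (B.card : ℝ) ≤ ((S.card / K : ℕ) : ℝ) + 1 := by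
    have : B.card ≤ S.card / K + 1 := hk
    exact_mod_cast this
  rw [← hX'] at hcross'
  linarith

end Summit.Ventures.Crystal3D.Theorems

end
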